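import Literature.Computability.Complexity.BISDownsetsTheorem5Proofs
import Literature.Computability.Complexity.LengthCompare
import Literature.ModelTheory.FiniteModelTheory.CPTCardPTIMECodeFP
import HarnessLib

/-!
# CPT+Card ⊆ PTIME: discharge of `CPTCardInPTIME` (Blass–Gurevich–Shelah 1999, Theorem 1)

Topic `Literature/ModelTheory/FiniteModelTheory`; sibling of `CPTCardProgram.lean`, whose named fact
`Literature.ModelTheory.FiniteModelTheory.CPTCardInPTIME` — for every PTime bounded BGS program with
counting `(Π, p, q)`, the classes of accepted and of rejected finite graphs are polynomial-time
decidable on adjacency codes — is PROVED here: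
`theorem CPTCardInPTIME_holds : CPTCardInPTIME`.

Blass–Gurevich–Shelah 1999, §5.2 Theorem 1: "Consider a PTime program Π̄ = (Π, p(n), q(n)). 1. There is
a PTime-bounded Turing machine that accepts exactly those strings that encode ordered versions of
input structures accepted by Π̄ and rejects exactly those … rejected by Π̄. Proof. The desired Turing
machine simulates the given PTime program. The bound `r` in a term `{s(v) : v ∈ r : g(v)}` and in a
do-forall rule ensures that the number of immediate subcomputations is bounded … polynomial bound on
the work needed to simulate one transition … the number of transitions is bounded by `p(n)`"; with
`Card`: Blass–Gurevich–Shelah 2002, §2 (C̃PT+Card ⊆ PTime). The formal simulation is the chain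
`CPTCardPTIMETable` (hash-consed HF tables) → `CPTCardPTIMEEval` (guarded interpreter, soundness) →
`CPTCardPTIMECensus` (active-object census, the run, soundness modulo overflow) → `CPTCardPTIMESize`
(no overflow within `budget P n`; this is where the printed remark on `r` is made quantitative through
the hereditary width, since with the printed definition of "active" an unstored range need not consist
of active objects) → `CPTCardPTIMECodeFP` (the whole simulation is `CodeFP`, i.e. runs on Mathlib's
`FinTM2` in polynomial time through the tree's `FP`). This file supplies the last step, READING THE
INPUT: a string `w` is the code of a finite graph iff re-encoding the graph read off `w` (size
`min (bitsToNat (fst w)) |w|`, adjacency bits `snd w`, decoded as `encodingGraph` does) returns `w`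
(`mem_graphClassLanguage_iff`); the decision procedure `decideStatus` = that test and the status of
the budgeted simulation, is `CodeFP` (`decideStatusFP`), whence `graphClassLanguage _ ∈ P`
(`mem_P_of_mem_FP`).

## References

* A. Blass, Y. Gurevich, S. Shelah, *Choiceless polynomial time*, Ann. Pure Appl. Logic 100 (1999)
  141–187 = arXiv:math/9705225, §5.2 Theorem 1 (with §5.1, §4.4–4.6).
* A. Blass, Y. Gurevich, S. Shelah, *On polynomial time computation over unordered structures*,
  J. Symbolic Logic 67 (2002) 1093–1125, §2.
* S. Arora, B. Barak, *Computational Complexity: A Modern Approach*, CUP 2009, §0.1 (adjacency-matrix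
  codes), §1.3.
-/

noncomputable section

namespace Literature.ModelTheory.FiniteModelTheory

open _root_.Computability Literature.Computability.Complexity Literature.Computability.Complexity.Classes
  Literature.Computability.Complexity.CodeFP Literature.Computability.Complexity.Brick
open Literature.Computability.Complexity.TwoColouring (encodingGraph_decode_of_length_eq)

namespace BGS.Sim

/-! ### Reading and re-writing graph codes -/

/-- The adjacency bit vector `encodingGraphFin` writes for the graph read off `(n, bits)`: bit
`k < n²` is the adjacency of `(k / n, k % n)`. [Arora–Barak 2009, §0.1] [folklore] -/
def canonBits (n : ℕ) (bits : List Bool) : List Bool :=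
  (List.range (n * n)).map fun k => TwoColouring.adj n bits (k / n) (k % n)

/-- The code of the graph read off `(n, bits)`. [folklore] -/
def reencode (n : ℕ) (bits : List Bool) : List Bool := boolPair (encodeNat n) (canonBits n bits)

/-- `List.ofFn` over `Fin m` as a map over `range m`. [folklore] -/
theorem ofFn_eq_map_range {α : Type} (m : ℕ) (g : ℕ → α) :
    (List.ofFn fun k : Fin m => g k.val) = (List.range m).map g := by
  apply List.ext_getElem (by simp)
  intro i h₁ h₂
  simp

/-- **The encoder writes `reencode`**: the code of the graph read off `(n, bits)` is
`⟨bin n, canonBits n bits⟩`. [Arora–Barak 2009, §0.1] [folklore] -/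
theorem encode_graph (n : ℕ) (bits : List Bool) :
    encodingGraph.encode ⟨n, TwoColouring.graph n bits⟩ = reencode n bits := by
  classical
  rw [encodingGraph_encode, reencode]
  congr 1
  show List.ofFn _ = canonBits n bits
  rw [canonBits, ← ofFn_eq_map_range (n * n) fun k => TwoColouring.adj n bits (k / n) (k % n)]
  congr 1
  funext k
  rw [Bool.eq_iff_iff]
  refine (@decide_eq_true_iff _ (Classical.propDecidable _)).trans ?_
  rw [TwoColouring.graph_adj, finProdFinEquiv_symm_apply, Fin.coe_divNat, Fin.coe_modNat]

/-- The size read off a string: its size numeral, capped by its length (a genuine code is at least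
as long as its number of vertices). [folklore] -/
def sizeOfCode (w : List Bool) : ℕ := min (bitsToNat (fstF w)) w.length

/-- A code is at least as long as its number of vertices. [folklore] -/
theorem le_length_encode (n : ℕ) (G : SimpleGraph (Fin n)) : n ≤ (encodingGraph.encode ⟨n, G⟩).length := by
  rw [encodingGraph_encode, length_boolPair]
  have : ((encodingGraphFin n).encode G).length = n * n := by
    show (List.ofFn _).length = n * n
    exact List.length_ofFn
  rw [this]
  nlinarith

/-- The size read off a genuine code. [folklore] -/
theorem sizeOfCode_encode (n : ℕ) (G : SimpleGraph (Fin n)) : sizeOfCode (encodingGraph.encode ⟨n, G⟩) = n := by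
  have h := le_length_encode n G
  have hf : bitsToNat (fstF (encodingGraph.encode ⟨n, G⟩)) = n := by
    rw [encodingGraph_encode, fstF_boolPair]
    exact bitsToNat_natE n
  rw [sizeOfCode, hf, min_eq_left h]

/-- The adjacency bits of a genuine code read back the graph. [folklore] -/
theorem graph_sndF_encode (n : ℕ) (G : SimpleGraph (Fin n)) :
    TwoColouring.graph n (sndF (encodingGraph.encode ⟨n, G⟩)) = G := by
  set w := encodingGraph.encode ⟨n, G⟩ with hw
  have hfst : decodeNat (fstF w) = n := by
    rw [hw, encodingGraph_encode, fstF_boolPair]; exact decode_encodeNat n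
  have hlen : (sndF w).length = decodeNat (fstF w) * decodeNat (fstF w) := by
    rw [hfst, hw, encodingGraph_encode, sndF_boolPair]
    show (List.ofFn _).length = n * n
    exact List.length_ofFn
  have h1 := encodingGraph_decode_of_length_eq hlen
  rw [hfst] at h1
  have h2 : encodingGraph.decode w = some ⟨n, G⟩ := by rw [hw]; exact encodingGraph.decode_encode _
  rw [h1] at h2
  obtain ⟨-, h⟩ := Sigma.mk.inj_iff.mp (Option.some.inj h2)
  exact eq_of_heq h

/-- **Membership in the language of a class of finite graphs, decided by re-encoding**: `w` is the code
of a member of `C` iff re-encoding the graph read off `w` gives back `w` and that graph is in `C`.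
[Arora–Barak 2009, §0.1; Gurevich 1988, §1] [folklore] -/
theorem mem_graphClassLanguage_iff (C : Set FinGraph) (w : List Bool) :
    w ∈ graphClassLanguage C ↔
      reencode (sizeOfCode w) (sndF w) = w ∧
        (⟨sizeOfCode w, TwoColouring.graph (sizeOfCode w) (sndF w)⟩ : FinGraph) ∈ C := by
  constructor
  · rintro ⟨⟨n, G⟩, hG, rfl⟩
    rw [sizeOfCode_encode, graph_sndF_encode]
    exact ⟨by rw [← encode_graph, graph_sndF_encode], hG⟩
  · rintro ⟨hw, hC⟩
    exact ⟨_, hC, by rw [encode_graph, hw]⟩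

/-! ### The decision procedure -/

/-- **The decision procedure** for "the budgeted simulation of `P` on the graph coded by `w` ends in
status `s`" (`s = 1`: accepted, `s = 2`: rejected), guarded by the code test.
[Blass–Gurevich–Shelah 1999, §5.2 Theorem 1] [folklore] -/
def decideStatus (P : CPTCardProgram) (s : ℕ) (w : List Bool) : Bool :=
  decide (reencode (sizeOfCode w) (sndF w) = w) &&
    ((runP P (budget P (sizeOfCode w)) (sizeOfCode w) (sndF w)).2.2.2 == s)

/-- `canonBits` on codes: `(1ⁿ, bits) ↦ canonBits n bits`. [folklore] -/
theorem canonBitsFP : CodeFP (pairE unE strE) strE (fun p => canonBits p.1 p.2) := by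
  have hn : CodeFP (pairE (pairE unE strE) natE) natE (fun q => q.1.1) := (natOfUn.comp (fst _ _).fst' :)
  have hij : CodeFP (pairE (pairE unE strE) natE) (pairE natE natE) (fun q => (q.2 / q.1.1, q.2 % q.1.1)) :=
    ((natDiv.comp ((snd _ _).pair hn)).pair (natMod.comp ((snd _ _).pair hn)) :)
  have hbit : CodeFP (pairE (pairE unE strE) natE) bitE (fun q => TwoColouring.adj q.1.1 q.1.2 (q.2 / q.1.1) (q.2 % q.1.1)) :=
    (TwoColouring.adjFP.comp ((fst _ _).pair hij) :)
  have hlist : CodeFP (pairE unE strE) (rawE natE) (fun p => List.range (p.1 * p.1)) :=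
    (urange.comp (unMul.comp ((fst _ _).pair (fst _ _))) :)
  have hmap : CodeFP (pairE unE strE) (rawE bitE)
      (fun p => (List.range (p.1 * p.1)).map fun k => TwoColouring.adj p.1 p.2 (k / p.1) (k % p.1)) :=
    ((map hbit).comp ((CodeFP.id _).pair hlist) :)
  exact ((bitsToStr.comp hmap).congr fun p => rfl)

/-- `reencode` on codes. [folklore] -/
theorem reencodeFP : CodeFP (pairE unE strE) strE (fun p => reencode p.1 p.2) := by
  have h : CodeFP (pairE unE strE) (pairE strE strE) (fun p => (natE p.1, canonBits p.1 p.2)) :=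
    ((strOfNat.comp (natOfUn.comp (fst _ _))).pair canonBitsFP :)
  exact CodeFP.recodeOut (eγ := strE) h fun _ => rfl

/-- The size read off a string, in unary. [folklore] -/
theorem sizeOfCodeFP : CodeFP strE unE sizeOfCode :=
  (unOfNatMin.comp (strLength.pair codeFP_hdrBody.fst')).congr fun w => by simp [sizeOfCode, Nat.min_comm]

/-- **The decision procedure is polynomial time on codes.** [Blass–Gurevich–Shelah 1999, §5.2
Theorem 1] [folklore] -/
theorem decideStatusFP (P : CPTCardProgram) (s : ℕ) : CodeFP strE bitE (decideStatus P s) := by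
  have hns : CodeFP strE (pairE unE strE) (fun w => (sizeOfCode w, sndF w)) := (sizeOfCodeFP.pair codeFP_hdrBody.snd' :)
  have htest : CodeFP strE bitE (fun w => decide (reencode (sizeOfCode w) (sndF w) = w)) :=
    ((CodeFP.eq (eα := strE) Function.injective_id).comp ((reencodeFP.comp hns).pair (CodeFP.id strE)) :)
  have hstat : CodeFP strE bitE (fun w => (runP P (budget P (sizeOfCode w)) (sizeOfCode w) (sndF w)).2.2.2 == s) :=
    ((beq natE_injective).comp (((runStatusFP P).comp hns).pair (const _ s)) :)
  exact (htest.and hstat).congr fun w => rfl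

/-- **A class of finite graphs read off the status of the budgeted simulation is polynomial time.**
[Blass–Gurevich–Shelah 1999, §5.2 Theorem 1] [folklore] -/
theorem isPTIMEClass_of_status (P : CPTCardProgram) (s : ℕ) (C : Set FinGraph)
    (hC : ∀ (n : ℕ) (adj : List Bool),
      (⟨n, TwoColouring.graph n adj⟩ : FinGraph) ∈ C ↔ (runP P (budget P n) n adj).2.2.2 = s) :
    IsPTIMEClass C := by
  obtain ⟨g, hg, hge⟩ := decideStatusFP P s
  refine mem_P_of_mem_FP hg (graphClassLanguage C) fun w => ?_
  have key : w ∈ graphClassLanguage C ↔ decideStatus P s w = true := by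
    rw [mem_graphClassLanguage_iff, hC, decideStatus, Bool.and_eq_true, decide_eq_true_eq, beq_iff_eq]
  have hgw : g w = [decideStatus P s w] := hge w
  constructor
  · intro hw; rw [hgw, key.mp hw]
  · intro hw
    rw [hgw]
    cases h : decideStatus P s w
    · rfl
    · exact absurd (key.mpr h) hw

end BGS.Sim

/-- **CPT+Card ⊆ PTIME (Blass–Gurevich–Shelah).** For every PTime bounded BGS program with counting,
the classes of accepted and of rejected finite graphs are polynomial-time decidable on adjacency codes:
the discharge of the named fact `CPTCardInPTIME`. The deciding machine simulates the bounded run on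
hash-consed hereditarily finite sets with an explicit polynomial budget (`BGS.Sim.runP`,
`BGS.Sim.budget`), reads acceptance / rejection off its status (`BGS.Sim.runP_status_iff`), and runs in
polynomial time on Mathlib's `FinTM2` through the tree's `FP` (`BGS.Sim.decideStatusFP`).
[cite: arXivmath9705225, Thm 1] -/
theorem CPTCardInPTIME_holds : CPTCardInPTIME := fun P =>
  ⟨BGS.Sim.isPTIMEClass_of_status P 1 _ fun n adj => (BGS.Sim.runP_status_iff P n adj).1.symm,
    BGS.Sim.isPTIMEClass_of_status P 2 _ fun n adj => (BGS.Sim.runP_status_iff P n adj).2.symm⟩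

end Literature.ModelTheory.FiniteModelTheory
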